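import Mathlib.MeasureTheory.Integral.Prod
import Mathlib.MeasureTheory.Integral.Bochner.Set
import Mathlib.MeasureTheory.Integral.Bochner.SumMeasure
import Mathlib.MeasureTheory.Function.L2Space
import Summits.QuantumFields.QCD.Theorems.QuarksAsStableActionStableActionBridgeStubRayleighOfInvariant
import Summits.QuantumFields.QCD.Theorems.QuarksAsStableActionStableActionBridgeStubInnerLeOfEigenLe
import Summits.QuantumFields.QCD.Theorems.QuarksAsStableActionStableActionBridgeStubBondKernelContinuous
import Summits.QuantumFields.QCD.Theorems.QuarksAsStableActionStableActionBridgeTransferPositivity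
import Literature.Analysis.OperatorTheory.HermitianKernelOperator
import HarnessLib

/-!
# Stub `stub_rayleigh_le_of_eigen_le` of line `twisted_trace_transfer`
# for crux `QuarksAsStableAction.StableActionBridge` (item stmt-QuantumFields-9737)

This file proves the registered stub `stub_rayleigh_le_of_eigen_le` (sub-goal C2 of step E3, wave 2,
of the lead skeleton of line `twisted_trace_transfer`): **every Rayleigh quotient of the form core is
bounded by the top eigenvalue of the scalarised transfer operator**, `sup_{core} R(Ψ) ≤ λ_max`.

Step E3 realises Lüscher's QCD transfer matrix (Lüscher, CMP 54 (1977); Smit, *Introduction to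
Quantum Fields on a Lattice*, §6.5 (6.87)) as a compact self-adjoint integral operator `A` on
`L²(Y, ρ)`, `Y = SU(3)^{E₃} × Finset(modes)`, `ρ = Haar ⊗ count`, with the Hermitian kernel
`k((U,s),(U',s')) = (R(U) B(U,U') R(U'))_{s s'}` (`R` a continuous pointwise Hermitian square root of
Smit's `T̂_F(U) = fermionSliceOp U mq`, `B` the Gauss-averaged Wilson bond kernel).  The stub: if `A`
is self-adjoint, given a.e. by the kernel `k`, and has a Hilbert basis of eigenvectors with (real)
eigenvalues `λᵢ ≤ Λ`, then `transferRayleigh β mq Ψ ≤ Λ` for every `Ψ ∈ transferCore` with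
`𝔫(Ψ,Ψ) = fermionWeightForm mq Ψ Ψ ≠ 0`.

## Proof

Let `v(U,s) := (R(U)Ψ(U))_s`; each section `U ↦ v(U,s)` is continuous on the compact configuration
space, so `v` is measurable on `Y` (countable second factor), bounded, and `v ∈ L²(ρ)`; let `φ` be its
class.
* `‖φ‖² = ∫ ‖v‖² dρ = ∫ Σ_s ‖(R(U)Ψ(U))_s‖² dU = 𝔫(Ψ,Ψ)` ("unscalarisation"
  `∫_Y f dρ = ∫ Σ_s f(U,s) dU`, Fubini for `Haar ⊗ count`, and clause (ii) of the landed sibling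
  `stub_rayleigh_of_invariant`).
* `⟪φ, Aφ⟫ = ∫ conj φ(y) ∫ k(y,y') φ(y') dρ dρ` (`inner_eq_integral_of_ae_kernel`); replacing the
  representative `φ` by `v` (a.e. equal), unscalarising both integrals (the outer integrand is
  continuous in `U`: a parametric integral of a jointly continuous function over a compact space;
  the sections of `k` are jointly continuous by `stub_bondKernel_continuous`) and pulling the finite
  sums through the inner integral gives the scalarised quadratic form of clause (i) of
  `stub_rayleigh_of_invariant`, i.e. `⟪φ, Aφ⟫ = 𝔱(Ψ,Ψ) = transferForm β mq Ψ Ψ`.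
* `Re ⟪φ, Aφ⟫ ≤ Λ ‖φ‖²` (`stub_inner_le_of_eigen_le`, Parseval in the eigenbasis); since
  `𝔫(Ψ,Ψ) = ‖φ‖²` is real, non-negative and non-zero, `R(Ψ) = Re 𝔱 / Re 𝔫 ≤ Λ`.

Pure theorem file (no definitions, no notation); the measure-theoretic helpers (functions on
`X × F` with `F` finite and continuous sections) live in the sub-namespace `StubRayleighLeOfEigenLe`
and are stated for an abstract compact `X`.

[cite: ReedSimonIV1978, Thm XIII.1] [cite: Luscher1977, pp. 283–292] [cite: Smit2023, §6.5 (6.87)]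
-/

noncomputable section

namespace Summit.QuantumFields.QCD.Cruxes.StableActionBridge.TwistedTraceTransfer

open MeasureTheory
open scoped InnerProductSpace ComplexConjugate Matrix BigOperators
open Literature.MathematicalPhysics.QuantumFieldTheory Literature.MathematicalPhysics.QuantumLattice
open Literature.Probability.LatticeModels (TorusSite)
open Literature.Analysis.OperatorTheory (norm_toLp_sq_eq_integral_norm_sq inner_eq_integral_of_ae_kernel)

namespace StubRayleighLeOfEigenLe

/-! ### Functions on `X × F`, `F` finite, with continuous sections -/

section Abstract

variable {X : Type*} [TopologicalSpace X] [CompactSpace X] [MeasurableSpace X] [OpensMeasurableSpace X]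
  {μ : Measure X} [IsFiniteMeasure μ]
  {F : Type*} [Fintype F] [MeasurableSpace F] [MeasurableSingletonClass F]
  {𝕜 : Type*} [RCLike 𝕜]

omit [CompactSpace X] in
/-- A function on `X × F` (`F` countable with measurable singletons) with continuous sections
`x ↦ f (x, s)` is measurable. [folklore] -/
theorem measurable_of_continuous_sections {f : X × F → 𝕜} (hf : ∀ s, Continuous fun x => f (x, s)) :
    Measurable f :=
  measurable_from_prod_countable_left fun s => (hf s).measurable

/-- A function on `X × F` with continuous sections is integrable for `μ ⊗ count`, `μ` finite, `X`
compact, `F` finite. [folklore] -/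
theorem integrable_prod_count {f : X × F → 𝕜} (hf : ∀ s, Continuous fun x => f (x, s)) :
    Integrable f (μ.prod (Measure.count : Measure F)) :=
  (integrable_prod_iff' (measurable_of_continuous_sections hf).aestronglyMeasurable).2
    ⟨Filter.Eventually.of_forall fun s =>
      (hf s).integrable_of_hasCompactSupport (HasCompactSupport.of_compactSpace _),
     Integrable.of_finite⟩

/-- **Unscalarisation**: `∫_{X × F} f d(μ ⊗ count) = ∫_X Σ_s f(x, s) dμ(x)` for `f` with continuous
sections (Fubini and `∫ d(count) = Σ` on the finite factor). [folklore] -/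
theorem integral_prod_count {f : X × F → 𝕜} (hf : ∀ s, Continuous fun x => f (x, s)) :
    ∫ y, f y ∂(μ.prod (Measure.count : Measure F)) = ∫ x, ∑ s, f (x, s) ∂μ := by
  rw [integral_prod f (integrable_prod_count hf)]
  simp only [integral_count]

/-- A function on `X × F` with continuous sections is in `L²(μ ⊗ count)`. [folklore] -/
theorem memLp_two_prod_count {f : X × F → 𝕜} (hf : ∀ s, Continuous fun x => f (x, s)) :
    MemLp f 2 (μ.prod (Measure.count : Measure F)) :=
  (memLp_two_iff_integrable_sq_norm (measurable_of_continuous_sections hf).aestronglyMeasurable).2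
    (integrable_prod_count (𝕜 := ℝ) (f := fun y => ‖f y‖ ^ 2) fun s => (hf s).norm.pow 2)

/-- The parametric integral `x ↦ ∫ G(x, x') dμ(x')` of a jointly continuous `G` over a finite
measure on a compact space is continuous (dominated convergence, Mathlib's
`continuous_parametric_integral_of_continuous` on the compact set `univ`). [folklore] -/
theorem continuous_integral_of_continuous₂ [FirstCountableTopology X] [LocallyCompactSpace X]
    {G : X → X → 𝕜} (hG : Continuous fun q : X × X => G q.1 q.2) :
    Continuous fun x => ∫ x', G x x' ∂μ := by
  have h := continuous_parametric_integral_of_continuous (μ := μ) (f := G) hG isCompact_univ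
  simpa only [Measure.restrict_univ] using h

/-- **`L²`-norm of a scalarised wave**: for `v` on `X × F` with continuous sections,
`‖[v]‖²_{L²(μ ⊗ count)} = ∫ Σ_s ‖v(x, s)‖² dμ(x)` (cast to `ℂ`). [folklore] -/
theorem ofReal_norm_toLp_sq {v : X × F → ℂ} (hvc : ∀ s, Continuous fun x => v (x, s))
    (hv : MemLp v 2 (μ.prod (Measure.count : Measure F))) :
    ((‖hv.toLp v‖ ^ 2 : ℝ) : ℂ) = ∫ x, ∑ s, ((‖v (x, s)‖ ^ 2 : ℝ) : ℂ) ∂μ := by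
  rw [norm_toLp_sq_eq_integral_norm_sq hv, ← integral_complex_ofReal]
  exact integral_prod_count (f := fun y => ((‖v y‖ ^ 2 : ℝ) : ℂ))
    fun s => Complex.continuous_ofReal.comp' ((hvc s).norm.pow 2)

/-- **Quadratic form of a kernel operator at a scalarised wave.**  If `A` on `L²(μ ⊗ count)` is given
a.e. by the kernel `k` whose sections `(x, x') ↦ k((x,s),(x',s'))` are jointly continuous, and `v` has
continuous sections, then
`⟪[v], A[v]⟫ = ∫∫ Σ_s Σ_s' conj v(x,s) · k((x,s),(x',s')) · v(x',s') dμ(x') dμ(x)`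
(kernel formula for the inner product, a.e. replacement of the representative, Fubini on both
`Haar ⊗ count` integrals, finite sums through the inner integral). [folklore] -/
theorem inner_toLp_eq_integral [FirstCountableTopology X] [LocallyCompactSpace X]
    {v : X × F → ℂ} (hvc : ∀ s, Continuous fun x => v (x, s))
    (hv : MemLp v 2 (μ.prod (Measure.count : Measure F)))
    {k : X × F → X × F → ℂ} (hkc : ∀ s s', Continuous fun q : X × X => k (q.1, s) (q.2, s'))
    {A : Lp ℂ 2 (μ.prod (Measure.count : Measure F)) →L[ℂ] Lp ℂ 2 (μ.prod (Measure.count : Measure F))}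
    (hAk : ∀ φ : Lp ℂ 2 (μ.prod (Measure.count : Measure F)),
      (A φ : X × F → ℂ) =ᵐ[μ.prod (Measure.count : Measure F)]
        fun y => ∫ y', k y y' * φ y' ∂(μ.prod (Measure.count : Measure F))) :
    ⟪hv.toLp v, A (hv.toLp v)⟫_ℂ =
      ∫ x, ∫ x', ∑ s, ∑ s', conj (v (x, s)) * k (x, s) (x', s') * v (x', s') ∂μ ∂μ := by
  -- sections of `k` in the second variable, for an arbitrary first argument
  have hk2 : ∀ (y : X × F) (s' : F), Continuous fun x' => k y (x', s') := by
    rintro ⟨x, s⟩ s'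
    exact (hkc s s').comp' (Continuous.prodMk_right x)
  -- the inner integral does not see the representative, and unscalarises
  have hin : ∀ y, ∫ y', k y y' * (hv.toLp v : X × F → ℂ) y' ∂(μ.prod (Measure.count : Measure F)) =
      ∫ x', ∑ s', k y (x', s') * v (x', s') ∂μ := fun y => by
    rw [← integral_prod_count (f := fun y' => k y y' * v y') fun s' => (hk2 y s').mul (hvc s')]
    exact integral_congr_ae (hv.coeFn_toLp.mono fun y' hy' => by simp only [hy'])
  -- the outer integrand, a.e.
  have hout : (fun y => conj ((hv.toLp v : X × F → ℂ) y) *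
        ∫ y', k y y' * (hv.toLp v : X × F → ℂ) y' ∂(μ.prod (Measure.count : Measure F)))
      =ᵐ[μ.prod (Measure.count : Measure F)]
        fun y => conj (v y) * ∫ x', ∑ s', k y (x', s') * v (x', s') ∂μ := by
    filter_upwards [hv.coeFn_toLp] with y hy
    rw [hy, hin y]
  -- the unscalarised inner integral is continuous in the outer configuration
  have hJ : ∀ s, Continuous fun x => ∫ x', ∑ s', k (x, s) (x', s') * v (x', s') ∂μ := fun s =>
    continuous_integral_of_continuous₂ (G := fun x x' => ∑ s', k (x, s) (x', s') * v (x', s'))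
      (continuous_finsetSum _ fun s' _ => (hkc s s').mul ((hvc s').comp' continuous_snd))
  calc ⟪hv.toLp v, A (hv.toLp v)⟫_ℂ
      = ∫ y, conj ((hv.toLp v : X × F → ℂ) y) *
          ∫ y', k y y' * (hv.toLp v : X × F → ℂ) y' ∂(μ.prod (Measure.count : Measure F))
          ∂(μ.prod (Measure.count : Measure F)) := inner_eq_integral_of_ae_kernel hAk _ _
    _ = ∫ y, conj (v y) * ∫ x', ∑ s', k y (x', s') * v (x', s') ∂μ
          ∂(μ.prod (Measure.count : Measure F)) := integral_congr_ae hout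
    _ = ∫ x, ∑ s, conj (v (x, s)) * ∫ x', ∑ s', k (x, s) (x', s') * v (x', s') ∂μ ∂μ :=
        integral_prod_count (f := fun y => conj (v y) * ∫ x', ∑ s', k y (x', s') * v (x', s') ∂μ)
          fun s => (Complex.continuous_conj.comp' (hvc s)).mul (hJ s)
    _ = ∫ x, ∫ x', ∑ s, ∑ s', conj (v (x, s)) * k (x, s) (x', s') * v (x', s') ∂μ ∂μ := by
        refine integral_congr_ae (Filter.Eventually.of_forall fun x => ?_)
        have hI : ∀ s, Integrable (fun x' => ∑ s', conj (v (x, s)) * k (x, s) (x', s') * v (x', s')) μ :=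
          fun s => StubRayleighOfInvariant.integrable_of_continuous (continuous_finsetSum _ fun s' _ =>
            (continuous_const.mul (hk2 (x, s) s')).mul (hvc s'))
        symm
        dsimp only
        rw [integral_finsetSum _ fun s _ => hI s]
        refine Finset.sum_congr rfl fun s _ => ?_
        rw [← integral_const_mul]
        refine integral_congr_ae (Filter.Eventually.of_forall fun x' => ?_)
        simp only [Finset.mul_sum, mul_assoc]

end Abstract

/-! ### The QCD kernel: continuity of the sections of `k = (R B R)_{s s'}` -/

/-- The sections `(U, U') ↦ k((U,s),(U',s')) = (R(U) B(U,U') R(U'))_{s s'}` of the scalarised QCD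
transfer kernel are jointly continuous (`R` continuous, `B` jointly continuous entrywise by
`stub_bondKernel_continuous`). [folklore] -/
theorem continuous_kernel_sections {Nf S : ℕ} [NeZero S] (β : ℝ)
    {R : GaugeConfig 3 S (Matrix.specialUnitaryGroup (Fin 3) ℂ) →
      Matrix (Finset (SliceFermiIdx Nf S)) (Finset (SliceFermiIdx Nf S)) ℂ} (hRc : Continuous R)
    {k : GaugeConfig 3 S (Matrix.specialUnitaryGroup (Fin 3) ℂ) × Finset (SliceFermiIdx Nf S) →
      GaugeConfig 3 S (Matrix.specialUnitaryGroup (Fin 3) ℂ) × Finset (SliceFermiIdx Nf S) → ℂ}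
    (hk : ∀ y y', k y y' = (R y.1 * (Matrix.of fun a c =>
        ∫ g : TorusSite 3 S → (Matrix.specialUnitaryGroup (Fin 3) ℂ),
          (gaugeSliceKernel β y.1 (gaugeTransform g y'.1) : ℂ) * @fockGaugeAct Nf S _ g a c
            ∂(Measure.pi fun _ => haarProbability (Matrix.specialUnitaryGroup (Fin 3) ℂ))) * R y'.1) y.2 y'.2)
    (s s' : Finset (SliceFermiIdx Nf S)) :
    Continuous fun q : GaugeConfig 3 S (Matrix.specialUnitaryGroup (Fin 3) ℂ) ×
        GaugeConfig 3 S (Matrix.specialUnitaryGroup (Fin 3) ℂ) => k (q.1, s) (q.2, s') := by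
  have hB : Continuous fun q : GaugeConfig 3 S (Matrix.specialUnitaryGroup (Fin 3) ℂ) ×
      GaugeConfig 3 S (Matrix.specialUnitaryGroup (Fin 3) ℂ) =>
      (Matrix.of fun a c => ∫ g : TorusSite 3 S → (Matrix.specialUnitaryGroup (Fin 3) ℂ),
          (gaugeSliceKernel β q.1 (gaugeTransform g q.2) : ℂ) * @fockGaugeAct Nf S _ g a c
            ∂(Measure.pi fun _ => haarProbability (Matrix.specialUnitaryGroup (Fin 3) ℂ))) :=
    continuous_matrix fun a c => by
      simpa only [Matrix.of_apply] using stub_bondKernel_continuous Nf S β a c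
  simp only [hk]
  exact (((hRc.comp' continuous_fst).mul hB).mul (hRc.comp' continuous_snd)).matrix_elem s s'

end StubRayleighLeOfEigenLe

open StubRayleighLeOfEigenLe

/-- **Sub-goal C2 of step E3 (registered stub `stub_rayleigh_le_of_eigen_le`): every Rayleigh quotient
of the core is bounded by the top eigenvalue of the scalarised transfer operator**
(`sup_{core} R(Ψ) ≤ λ_max`).  If `A` is self-adjoint on `L²(Haar ⊗ count)`, given a.e. by the kernel
`k((U,s),(U',s')) = (R(U) B(U,U') R(U'))_{s s'}` (`R` a continuous pointwise Hermitian square root of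
`T̂_F = fermionSliceOp`, `B` the Gauss-averaged Wilson bond kernel), and has a Hilbert basis of
eigenvectors with eigenvalues `λᵢ ≤ Λ`, then `transferRayleigh β mq Ψ ≤ Λ` for every
`Ψ ∈ transferCore` with `𝔫(Ψ,Ψ) ≠ 0`: the `L²` class `φ` of `(U,s) ↦ (R(U)Ψ(U))_s` has
`⟪φ, Aφ⟫ = 𝔱(Ψ,Ψ)` and `‖φ‖² = 𝔫(Ψ,Ψ)` (`stub_rayleigh_of_invariant`), and `Re ⟪φ, Aφ⟫ ≤ Λ ‖φ‖²`
(`stub_inner_le_of_eigen_le`). [cite: ReedSimonIV1978, Thm XIII.1] [cite: Luscher1977, pp. 283–292] -/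
theorem stub_rayleigh_le_of_eigen_le : ∀ (Nf S : ℕ) [NeZero S] (β : ℝ) (mq : Fin Nf → ℝ), (∀ f, -1 < mq f) →
    ∀ R : GaugeConfig 3 S (Matrix.specialUnitaryGroup (Fin 3) ℂ) → Matrix (Finset (SliceFermiIdx Nf S)) (Finset (SliceFermiIdx Nf S)) ℂ,
    Continuous R → (∀ U, (R U)ᴴ = R U ∧ R U * R U = fermionSliceOp U mq) →
    ∀ k : GaugeConfig 3 S (Matrix.specialUnitaryGroup (Fin 3) ℂ) × Finset (SliceFermiIdx Nf S) → GaugeConfig 3 S (Matrix.specialUnitaryGroup (Fin 3) ℂ) × Finset (SliceFermiIdx Nf S) → ℂ,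
    (∀ y y', k y y' = (R y.1 * (Matrix.of fun a c => ∫ g : TorusSite 3 S → (Matrix.specialUnitaryGroup (Fin 3) ℂ),
          (gaugeSliceKernel β y.1 (gaugeTransform g y'.1) : ℂ) * @fockGaugeAct Nf S _ g a c
            ∂(Measure.pi fun _ => haarProbability (Matrix.specialUnitaryGroup (Fin 3) ℂ))) * R y'.1) y.2 y'.2) →
    ∀ A : Lp ℂ 2 ((sliceHaar S).prod (Measure.count : Measure (Finset (SliceFermiIdx Nf S)))) →L[ℂ]
        Lp ℂ 2 ((sliceHaar S).prod (Measure.count : Measure (Finset (SliceFermiIdx Nf S)))),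
      IsSelfAdjoint A →
      (∀ φ : Lp ℂ 2 ((sliceHaar S).prod (Measure.count : Measure (Finset (SliceFermiIdx Nf S)))),
        (A φ : GaugeConfig 3 S (Matrix.specialUnitaryGroup (Fin 3) ℂ) × Finset (SliceFermiIdx Nf S) → ℂ)
          =ᵐ[(sliceHaar S).prod (Measure.count : Measure (Finset (SliceFermiIdx Nf S)))]
          fun y => ∫ y', k y y' * φ y' ∂((sliceHaar S).prod (Measure.count : Measure (Finset (SliceFermiIdx Nf S))))) →
    ∀ (ι : Type) (b : HilbertBasis ι ℂ (Lp ℂ 2 ((sliceHaar S).prod (Measure.count : Measure (Finset (SliceFermiIdx Nf S))))))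
      (lam : ι → ℝ), (∀ i, A (b i) = (lam i : ℂ) • (b i : Lp ℂ 2 ((sliceHaar S).prod
        (Measure.count : Measure (Finset (SliceFermiIdx Nf S)))))) →
    ∀ Λ : ℝ, (∀ i, lam i ≤ Λ) →
    ∀ Ψ : SliceWave Nf S, Ψ ∈ transferCore Nf S → fermionWeightForm mq Ψ Ψ ≠ 0 →
      transferRayleigh β mq Ψ ≤ Λ := by
  intro Nf S _ β mq hm R hRc hR k hk A hA hAk ι b lam hb Λ hΛ Ψ hΨ hn
  haveI := Sketch.isProbabilityMeasure_sliceHaar S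
  -- the two identities of the landed sibling B4 on the gauge-invariant wave `Ψ`
  obtain ⟨h1, h2⟩ := stub_rayleigh_of_invariant Nf S β mq hm R hRc hR Ψ hΨ
  -- the scalarised wave `v(U, s) = (R(U)Ψ(U))_s`: continuous sections, hence in `L²`
  have hRΨ : Continuous fun U => R U *ᵥ Ψ U := hRc.matrix_mulVec hΨ.1
  have hvs : ∀ s : Finset (SliceFermiIdx Nf S),
      Continuous fun U : GaugeConfig 3 S (Matrix.specialUnitaryGroup (Fin 3) ℂ) => (R U *ᵥ Ψ U) s :=
    fun s => (continuous_apply s).comp' hRΨ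
  have hv : MemLp (fun y : GaugeConfig 3 S (Matrix.specialUnitaryGroup (Fin 3) ℂ) × Finset (SliceFermiIdx Nf S) =>
      (R y.1 *ᵥ Ψ y.1) y.2) 2 ((sliceHaar S).prod (Measure.count : Measure (Finset (SliceFermiIdx Nf S)))) :=
    memLp_two_prod_count hvs
  -- sections of the kernel are jointly continuous
  have hkc := continuous_kernel_sections β hRc hk
  -- `‖φ‖² = 𝔫(Ψ,Ψ)`
  have hnorm : fermionWeightForm mq Ψ Ψ = ((‖hv.toLp _‖ ^ 2 : ℝ) : ℂ) := by
    rw [ofReal_norm_toLp_sq hvs hv]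
    exact h2.symm
  -- `⟪φ, Aφ⟫ = 𝔱(Ψ,Ψ)`
  have h1' : ∫ U, ∫ U', ∑ s, ∑ s', conj ((R U *ᵥ Ψ U) s) * k (U, s) (U', s') * (R U' *ᵥ Ψ U') s'
      ∂(sliceHaar S) ∂(sliceHaar S) = transferForm β mq Ψ Ψ := by
    simp only [hk]
    exact h1
  have hform : ⟪hv.toLp _, A (hv.toLp _)⟫_ℂ = transferForm β mq Ψ Ψ :=
    (inner_toLp_eq_integral hvs hv hkc hAk).trans h1'
  -- `Re ⟪φ, Aφ⟫ ≤ Λ ‖φ‖²` and the division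
  have hle := stub_inner_le_of_eigen_le _ A hA ι b lam hb Λ hΛ (hv.toLp _)
  have hre : (fermionWeightForm mq Ψ Ψ).re = ‖hv.toLp _‖ ^ 2 := by
    rw [hnorm, Complex.ofReal_re]
  have hpos : 0 < ‖hv.toLp _‖ ^ 2 :=
    (sq_nonneg _).lt_of_ne fun h0 => hn (by rw [hnorm, ← h0, Complex.ofReal_zero])
  unfold transferRayleigh
  rw [hre, div_le_iff₀ hpos, ← hform]
  exact hle

end Summit.QuantumFields.QCD.Cruxes.StableActionBridge.TwistedTraceTransfer

end
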